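import Mathlib
import HarnessLib
import Summits.HubbardSuperconductivity.HubbardSuperconductivity.Theorems.KLProgrammeKLRegimeEngineScaleZeroSmearingTailProfile
import Summits.HubbardSuperconductivity.HubbardSuperconductivity.Theorems.KLProgrammeKLRegimeEnginePairTransferGridSmearing

/-!
# K3 ENGINE-FLOW child (stmt-HubbardSuperconductivity-20437 `KLRegimeEngineV17F2`), located «(X).2′-BASE-ROOM», cure (β) «SCALE0-MEMBER-DIFF», part F4b:
# THE SMEARED TAIL'S MEMBER DIFFERENCE IS PURE THIRD ORDER — `96(N/β)·4096ρ⁻⁶·κD²·A(1+8γ²ρ⁻²)(1+32κD²ρ⁻²)·θ²`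

Cell `gate-hubbard-kl`, seat hubbard-kl-k3c5-p1 (g22).  F4a (`…SmearingTailProfile`) gave the tail `T₃` of the grid scale-`0` action the pinned profile
`ρ^{-2m′}·A·θ^{max(2,m′−2)}`.  Here it is fed to k3c1-p1 g14's TWO-LEVEL binomial–Gram values lemma `klmg_vertexFn_map_gaussConv_sub_le_binomial₂` (member line
`SᵀD′S`, Gram `γ`; difference line `SᵀD₁S`, Gram `κD`), with two new series majorants for the two-regime profile:

* §1 `klst_sum_ite_le_head_add_geom` (abstract), `klst_inner_twoRegime_le` (the profile is reproduced with `ρ⁻¹ ↦ 2ρ⁻¹`, `A ↦ A(1+8γ²ρ⁻²)`),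
  `klst_outer_twoRegime_le` (`Σ_{m′>2} C(2m′,4)κD^{2m′−4}(…) ≤ 4096ρ⁻⁶κD²A′θ²(1+32κD²ρ⁻²)`);
* §2 `scaleZero_tail_eq_map_grid` — the momentum-space tail (F1's `T₃` over `C^K_{>Λ}`, `W = V_U + 𝒩_K`) is the grid image of F4a's tail;
* §3 **`norm_vertexFn_smearedTail_sub_le_of_gridStep`** — for ANY momentum-label matrices `D′, D₁` whose grid pullbacks are Gram-bounded by `γ, κD`, in k3c2-p1 g5's step data
  with `4γ²θρ⁻² ≤ 1/2`, `16κD²θρ⁻² ≤ 1/2`: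
  `‖𝒱₄(e^{Δ_{D₁+D′}}T₃)(X) − 𝒱₄(e^{Δ_{D′}}T₃)(X)‖ ≤ (96N/β)·4096·ρ⁻⁶·κD²·(A(1+8γ²ρ⁻²))·θ²·(1+32κD²ρ⁻²)`, `A = e‖Ṽ‖_h/(1−θ)` — versus the FULL action's
  `(96N/β)·80·A·ρ⁻⁴·(4κD²θρ⁻²)` (k3c2-p1/k3c1-p1): one more `θ ∝ U`, i.e. the tail of the member difference is `O(ms·U³)`.

F5 closes the constants (`κ₀ = ρ = √12108`, `γ² = 6047`, `κD² = Λ₀·klIdxMass 0 j′`, `(N/β)‖Ṽ‖_h ≤ CV·U`, `θ ≤ ThetaC·U`).  Nothing here asserts row (X), any stub, K3, U₀ or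
superconductivity.  References: BGM 2006 (2.13)–(2.14), (2.77)–(2.80) [cite: BenfattoGiulianiMastropietro2006]; Pedra–Salmhofer 2008 Thm 2.4 [cite: PedraSalmhofer2008].
-/

noncomputable section

namespace Summit.HubbardSuperconductivity.HubbardSuperconductivity.Theorems.EngineV8

set_option linter.dupNamespace false -- summit = problem name (single-conjunct summit), D-0017

open Real Finset Literature.MathematicalPhysics.QuantumLattice Literature.Probability.LatticeModels
open Literature.MathematicalPhysics.QuantumLattice.GrassmannAlgebra GrassmannAlgebra
open Summit.HubbardSuperconductivity.HubbardSuperconductivity.Theorems.KLRegimeSplit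
open Summit.HubbardSuperconductivity.HubbardSuperconductivity.Theorems.KLRegimeWick
open Summit.HubbardSuperconductivity.HubbardSuperconductivity.Theorems.KLProgrammeLegKernels

/-! ## §1 Series majorants for the two-regime profile -/

section Majorants


/-- **Abstract two-regime geometric majorant**: a sum over `n ≥ n₀` whose head term is `≤ X` and whose `k`-th later term is `≤ X·c·z^{k-1}`
(`0 ≤ z ≤ 1/2`) is at most `X·(1 + 2c)`. -/
theorem klst_sum_ite_le_head_add_geom (B n₀ : ℕ) (a : ℕ → ℝ) {X c z : ℝ} (hX : 0 ≤ X) (hc : 0 ≤ c) (hz0 : 0 ≤ z) (hz : z ≤ 1 / 2)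
    (hhead : a n₀ ≤ X) (htail : ∀ k : ℕ, a (n₀ + (k + 1)) ≤ X * c * z ^ k) :
    (∑ n ∈ range B, if n₀ ≤ n then a n else 0) ≤ X * (1 + 2 * c) := by
  have hz1 : z < 1 := by linarith
  have hterm : ∀ n, (if n₀ ≤ n then a n else 0) ≤ (if n = n₀ then X else 0) + X * c * (if n₀ < n then z ^ (n - n₀ - 1) else 0) := by
    intro n
    by_cases h1 : n₀ ≤ n
    · rw [if_pos h1]
      rcases h1.eq_or_lt with h2 | h2
      · subst h2; simp [hhead]
      · rw [if_neg (by omega), if_pos h2, zero_add]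
        obtain ⟨k, rfl⟩ : ∃ k, n = n₀ + (k + 1) := ⟨n - n₀ - 1, by omega⟩
        rw [show n₀ + (k + 1) - n₀ - 1 = k by omega]
        exact htail k
    · rw [if_neg h1, if_neg (by omega), if_neg (by omega), mul_zero, add_zero]
  refine (sum_le_sum fun n _ => hterm n).trans ?_
  rw [sum_add_distrib, ← mul_sum]
  have hhead' : ∑ n ∈ range B, (if n = n₀ then X else 0) ≤ X := by
    rw [sum_ite_eq']; split_ifs <;> simp [hX]
  have hgeo : ∑ n ∈ range B, (if n₀ < n then z ^ (n - n₀ - 1) else 0) ≤ 2 := by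
    rw [← sum_filter]
    have hset : (range B).filter (fun n => n₀ < n) = Ico (n₀ + 1) B := by
      ext n; simp only [mem_filter, mem_range, mem_Ico]; omega
    rw [hset]
    rcases le_or_gt (n₀ + 1) B with hB | hB
    · rw [sum_Ico_eq_sum_range]
      simp only [show ∀ i : ℕ, n₀ + 1 + i - n₀ - 1 = i from fun i => by omega]
      have h := geom_sum_Ico_le_of_lt_one (m := 0) (n := B - (n₀ + 1)) hz0 hz1
      rw [range_eq_Ico]
      refine h.trans ?_
      rw [pow_zero, div_le_iff₀ (by linarith)]
      linarith
    · rw [Ico_eq_empty (by omega), sum_empty]; norm_num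
  calc ∑ n ∈ range B, (if n = n₀ then X else 0) + X * c * ∑ n ∈ range B, (if n₀ < n then z ^ (n - n₀ - 1) else 0)
      ≤ X + X * c * 2 := add_le_add hhead' (mul_le_mul_of_nonneg_left hgeo (by positivity))
    _ = X * (1 + 2 * c) := by ring

/-- `(2ρ)^{2n} = 4ⁿ·ρ^{2n}`. -/
theorem klst_two_mul_pow_two_mul (ρi : ℝ) (n : ℕ) : (2 * ρi) ^ (2 * n) = (4 : ℝ) ^ n * ρi ^ (2 * n) := by
  rw [pow_mul, pow_mul, show (2 * ρi) ^ 2 = 4 * ρi ^ 2 by ring, mul_pow]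

/-- **Inner level** — the soft member line through the tail's two-regime profile: for `m′ ≥ 3`, `y = 4γ²θρᵢ² ≤ 1/2`, `θ ≤ 1`,
`Σ_{m″ < B} [m′ ≤ m″]·C(2m″,2m′)·γ^{2m″−2m′}·(ρᵢ^{2m″}·A·θ^{max(2,m″−2)}) ≤ (2ρᵢ)^{2m′}·(A·(1 + 8γ²ρᵢ²))·θ^{max(2,m′−2)}` — the profile is REPRODUCED with `ρᵢ ↦ 2ρᵢ`.
[cite: BenfattoGiulianiMastropietro2006, (2.77)-(2.80)] -/
theorem klst_inner_twoRegime_le (B : ℕ) {γ θ ρi A : ℝ} (hγ : 0 ≤ γ) (hθ : 0 ≤ θ) (hθ1 : θ ≤ 1) (hρi : 0 ≤ ρi) (hA : 0 ≤ A)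
    (hy : 4 * (γ ^ 2 * θ * ρi ^ 2) ≤ 1 / 2) {m' : ℕ} (hm' : 3 ≤ m') :
    ∑ m'' ∈ range B, (if m' ≤ m'' then ((2 * m'').choose (2 * m') : ℝ) * γ ^ (2 * m'' - 2 * m') * (ρi ^ (2 * m'') * A * θ ^ max 2 (m'' - 2)) else 0) ≤
      (2 * ρi) ^ (2 * m') * (A * (1 + 8 * (γ ^ 2 * ρi ^ 2))) * θ ^ max 2 (m' - 2) := by
  set X : ℝ := (2 * ρi) ^ (2 * m') * A * θ ^ max 2 (m' - 2) with hX
  have hX0 : 0 ≤ X := by positivity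
  have hch : ∀ m'' : ℕ, ((2 * m'').choose (2 * m') : ℝ) ≤ (4 : ℝ) ^ m'' := fun m'' => by
    have h := Nat.choose_le_two_pow (2 * m'') (2 * m')
    rw [pow_mul] at h
    exact_mod_cast h
  have hhead : ((2 * m').choose (2 * m') : ℝ) * γ ^ (2 * m' - 2 * m') * (ρi ^ (2 * m') * A * θ ^ max 2 (m' - 2)) ≤ X := by
    rw [Nat.choose_self, Nat.cast_one, one_mul, Nat.sub_self, pow_zero, one_mul, hX]
    have : ρi ^ (2 * m') ≤ (2 * ρi) ^ (2 * m') := pow_le_pow_left₀ hρi (by linarith) _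
    exact mul_le_mul_of_nonneg_right (mul_le_mul_of_nonneg_right this hA) (by positivity)
  have htail : ∀ k : ℕ, ((2 * (m' + (k + 1))).choose (2 * m') : ℝ) * γ ^ (2 * (m' + (k + 1)) - 2 * m') *
      (ρi ^ (2 * (m' + (k + 1))) * A * θ ^ max 2 (m' + (k + 1) - 2)) ≤ X * (4 * (γ ^ 2 * ρi ^ 2)) * (4 * (γ ^ 2 * θ * ρi ^ 2)) ^ k := by
    intro k
    have hexp : θ ^ max 2 (m' + (k + 1) - 2) ≤ θ ^ max 2 (m' - 2) * θ ^ k := by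
      rw [← pow_add]
      exact pow_le_pow_of_le_one hθ hθ1 (by omega)
    calc ((2 * (m' + (k + 1))).choose (2 * m') : ℝ) * γ ^ (2 * (m' + (k + 1)) - 2 * m') * (ρi ^ (2 * (m' + (k + 1))) * A * θ ^ max 2 (m' + (k + 1) - 2))
        ≤ (4 : ℝ) ^ (m' + (k + 1)) * γ ^ (2 * (m' + (k + 1)) - 2 * m') * (ρi ^ (2 * (m' + (k + 1))) * A * (θ ^ max 2 (m' - 2) * θ ^ k)) := by
          gcongr
          exact hch _
      _ = X * (4 * (γ ^ 2 * ρi ^ 2)) * (4 * (γ ^ 2 * θ * ρi ^ 2)) ^ k := by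
          rw [hX, klst_two_mul_pow_two_mul, show 2 * (m' + (k + 1)) - 2 * m' = 2 * (k + 1) by omega,
            show 2 * (m' + (k + 1)) = 2 * m' + 2 * (k + 1) by ring, pow_add (4 : ℝ), pow_add ρi]
          simp only [pow_succ, pow_mul, mul_pow]
          ring
  have hmain := klst_sum_ite_le_head_add_geom B m'
    (fun m'' => ((2 * m'').choose (2 * m') : ℝ) * γ ^ (2 * m'' - 2 * m') * (ρi ^ (2 * m'') * A * θ ^ max 2 (m'' - 2)))
    hX0 (by positivity : (0 : ℝ) ≤ 4 * (γ ^ 2 * ρi ^ 2)) (by positivity : (0 : ℝ) ≤ 4 * (γ ^ 2 * θ * ρi ^ 2)) hy hhead htail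
  refine hmain.trans (le_of_eq ?_)
  rw [hX]; ring

/-- **Outer level** — the member-DIFFERENCE line (Gram constant `κD`, output degree `4`) through the inner profile: with `16κD²θρᵢ² ≤ 1/2`, `θ ≤ 1`,
`Σ_{m′ < B} [2 < m′]·C(2m′,4)·κD^{2m′−4}·((2ρᵢ)^{2m′}·A′·θ^{max(2,m′−2)}) ≤ 4096·ρᵢ⁶·κD²·A′·θ²·(1 + 32κD²ρᵢ²)` — ONE factor `κD²` (the mass of the difference line)
and TWO factors `θ` beyond `A′`. [cite: BenfattoGiulianiMastropietro2006, (2.77)-(2.80)] -/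
theorem klst_outer_twoRegime_le (B : ℕ) {κD θ ρi A' : ℝ} (hκD : 0 ≤ κD) (hθ : 0 ≤ θ) (hθ1 : θ ≤ 1) (hρi : 0 ≤ ρi) (hA : 0 ≤ A')
    (hz : 16 * (κD ^ 2 * θ * ρi ^ 2) ≤ 1 / 2) :
    ∑ m' ∈ range B, (if 2 < m' then ((2 * m').choose (2 * 2) : ℝ) * κD ^ (2 * m' - 2 * 2) * ((2 * ρi) ^ (2 * m') * A' * θ ^ max 2 (m' - 2)) else 0) ≤
      4096 * ρi ^ 6 * κD ^ 2 * A' * θ ^ 2 * (1 + 32 * (κD ^ 2 * ρi ^ 2)) := by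
  set X : ℝ := 4096 * ρi ^ 6 * κD ^ 2 * A' * θ ^ 2 with hX
  have hX0 : 0 ≤ X := by positivity
  have hch : ∀ m' : ℕ, ((2 * m').choose (2 * 2) : ℝ) ≤ (4 : ℝ) ^ m' := fun m' => by
    have h := Nat.choose_le_two_pow (2 * m') (2 * 2)
    rw [pow_mul] at h
    exact_mod_cast h
  have hsum : ∑ m' ∈ range B, (if 2 < m' then ((2 * m').choose (2 * 2) : ℝ) * κD ^ (2 * m' - 2 * 2) * ((2 * ρi) ^ (2 * m') * A' * θ ^ max 2 (m' - 2)) else 0) =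
      ∑ m' ∈ range B, (if 3 ≤ m' then ((2 * m').choose (2 * 2) : ℝ) * κD ^ (2 * m' - 2 * 2) * ((2 * ρi) ^ (2 * m') * A' * θ ^ max 2 (m' - 2)) else 0) :=
    sum_congr rfl fun m' _ => by
      by_cases h : 2 < m'
      · rw [if_pos h, if_pos (by omega)]
      · rw [if_neg h, if_neg (by omega)]
  rw [hsum]
  have hhead : ((2 * 3).choose (2 * 2) : ℝ) * κD ^ (2 * 3 - 2 * 2) * ((2 * ρi) ^ (2 * 3) * A' * θ ^ max 2 (3 - 2)) ≤ X := by
    rw [show (2 * 3 : ℕ).choose (2 * 2) = 15 by decide, show 2 * 3 - 2 * 2 = 2 from rfl, show max 2 (3 - 2) = 2 from rfl, hX]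
    have hP : 0 ≤ ρi ^ 6 * κD ^ 2 * A' * θ ^ 2 := by positivity
    calc ((15 : ℕ) : ℝ) * κD ^ 2 * ((2 * ρi) ^ (2 * 3) * A' * θ ^ 2) = 960 * (ρi ^ 6 * κD ^ 2 * A' * θ ^ 2) := by push_cast; ring
      _ ≤ 4096 * (ρi ^ 6 * κD ^ 2 * A' * θ ^ 2) := mul_le_mul_of_nonneg_right (by norm_num) hP
      _ = _ := by ring
  have htail : ∀ k : ℕ, ((2 * (3 + (k + 1))).choose (2 * 2) : ℝ) * κD ^ (2 * (3 + (k + 1)) - 2 * 2) *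
      ((2 * ρi) ^ (2 * (3 + (k + 1))) * A' * θ ^ max 2 (3 + (k + 1) - 2)) ≤ X * (16 * (κD ^ 2 * ρi ^ 2)) * (16 * (κD ^ 2 * θ * ρi ^ 2)) ^ k := by
    intro k
    have hexp : θ ^ max 2 (3 + (k + 1) - 2) ≤ θ ^ 2 * θ ^ k := by
      rw [← pow_add]
      exact pow_le_pow_of_le_one hθ hθ1 (by omega)
    calc ((2 * (3 + (k + 1))).choose (2 * 2) : ℝ) * κD ^ (2 * (3 + (k + 1)) - 2 * 2) * ((2 * ρi) ^ (2 * (3 + (k + 1))) * A' * θ ^ max 2 (3 + (k + 1) - 2))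
        ≤ (4 : ℝ) ^ (3 + (k + 1)) * κD ^ (2 * (3 + (k + 1)) - 2 * 2) * ((2 * ρi) ^ (2 * (3 + (k + 1))) * A' * (θ ^ 2 * θ ^ k)) := by
          gcongr
          exact hch _
      _ = X * (16 * (κD ^ 2 * ρi ^ 2)) * (16 * (κD ^ 2 * θ * ρi ^ 2)) ^ k := by
          rw [hX, klst_two_mul_pow_two_mul, show 2 * (3 + (k + 1)) - 2 * 2 = 2 * (k + 2) by omega, show 3 + (k + 1) = k + 4 by ring,
            show (16 : ℝ) = 4 ^ 2 by norm_num]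
          simp only [pow_succ, mul_pow, pow_zero, one_mul]
          ring
  have hmain := klst_sum_ite_le_head_add_geom B 3
    (fun m' => ((2 * m').choose (2 * 2) : ℝ) * κD ^ (2 * m' - 2 * 2) * ((2 * ρi) ^ (2 * m') * A' * θ ^ max 2 (m' - 2)))
    hX0 (by positivity : (0 : ℝ) ≤ 16 * (κD ^ 2 * ρi ^ 2)) (by positivity : (0 : ℝ) ≤ 16 * (κD ^ 2 * θ * ρi ^ 2)) hz hhead htail
  refine hmain.trans (le_of_eq ?_)
  rw [hX]; ring


end Majorants

/-! ## §2 The momentum-space tail is the grid image of the grid tail -/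

section Grid

variable {L M : ℕ} [NeZero L] [NeZero M]

/-- **The momentum-space tail is a grid image**: with `S = hubbardGridSub … (4M)`, `W = V_U + 𝒩_K = map S Ṽ`, `C′ = SᵀC^K_{>Λ}S`:
`effAction C W − e^{Δ_C}W + ½(e^{Δ_C}(W·W) − e^{Δ_C}W·e^{Δ_C}W) = map S (effAction C′Ṽ − e^{Δ_{C′}}Ṽ + ½(e^{Δ_{C′}}(Ṽ·Ṽ) − e^{Δ_{C′}}Ṽ·e^{Δ_{C′}}Ṽ))`
(`effAction_map`, `gaussConv_map`, `map_hubbardGridSub_gridInteractionCT`). [cite: Salmhofer1999, §2.5.1 (2.105)] -/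
theorem scaleZero_tail_eq_map_grid {β : ℝ} (hβ : β ≠ 0) (U μ : ℝ) (K : TrigPolyC4v) (Λ : ℝ) :
    effAction ℂ (hubbardCovAboveCT L M β μ 0 K Λ) (hubbardInteractionCT L M β U K) - gaussConv ℂ (hubbardCovAboveCT L M β μ 0 K Λ) (hubbardInteractionCT L M β U K) +
        (2 : ℂ)⁻¹ • (gaussConv ℂ (hubbardCovAboveCT L M β μ 0 K Λ) (hubbardInteractionCT L M β U K * hubbardInteractionCT L M β U K) -
          gaussConv ℂ (hubbardCovAboveCT L M β μ 0 K Λ) (hubbardInteractionCT L M β U K) * gaussConv ℂ (hubbardCovAboveCT L M β μ 0 K Λ) (hubbardInteractionCT L M β U K)) =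
      ExteriorAlgebra.map (Matrix.toLin' (hubbardGridSub L M β (2 * (2 * M))))
        (effAction ℂ ((hubbardGridSub L M β (2 * (2 * M))).transpose * hubbardCovAboveCT L M β μ 0 K Λ * hubbardGridSub L M β (2 * (2 * M)))
            (hubbardGridInteraction L (2 * (2 * M)) β U + hubbardGridCounterQuadratic L (2 * (2 * M)) β K) -
          gaussConv ℂ ((hubbardGridSub L M β (2 * (2 * M))).transpose * hubbardCovAboveCT L M β μ 0 K Λ * hubbardGridSub L M β (2 * (2 * M)))
            (hubbardGridInteraction L (2 * (2 * M)) β U + hubbardGridCounterQuadratic L (2 * (2 * M)) β K) +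
          (2 : ℂ)⁻¹ • (gaussConv ℂ ((hubbardGridSub L M β (2 * (2 * M))).transpose * hubbardCovAboveCT L M β μ 0 K Λ * hubbardGridSub L M β (2 * (2 * M)))
              ((hubbardGridInteraction L (2 * (2 * M)) β U + hubbardGridCounterQuadratic L (2 * (2 * M)) β K) *
                (hubbardGridInteraction L (2 * (2 * M)) β U + hubbardGridCounterQuadratic L (2 * (2 * M)) β K)) -
            gaussConv ℂ ((hubbardGridSub L M β (2 * (2 * M))).transpose * hubbardCovAboveCT L M β μ 0 K Λ * hubbardGridSub L M β (2 * (2 * M)))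
                (hubbardGridInteraction L (2 * (2 * M)) β U + hubbardGridCounterQuadratic L (2 * (2 * M)) β K) *
              gaussConv ℂ ((hubbardGridSub L M β (2 * (2 * M))).transpose * hubbardCovAboveCT L M β μ 0 K Λ * hubbardGridSub L M β (2 * (2 * M)))
                (hubbardGridInteraction L (2 * (2 * M)) β U + hubbardGridCounterQuadratic L (2 * (2 * M)) β K))) := by
  haveI : NeZero (2 * (2 * M)) := ⟨by have := NeZero.ne M; omega⟩
  have hW : hubbardInteractionCT L M β U K = ExteriorAlgebra.map (Matrix.toLin' (hubbardGridSub L M β (2 * (2 * M))))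
      (hubbardGridInteraction L (2 * (2 * M)) β U + hubbardGridCounterQuadratic L (2 * (2 * M)) β K) :=
    (map_hubbardGridSub_gridInteractionCT (L := L) (M := M) (N := 2 * (2 * M)) hβ U K (by omega) (by omega)).symm
  rw [hW, effAction_map, gaussConv_map, ← map_mul, gaussConv_map, LinearMap.toMatrix'_toLin']
  simp only [map_sub, map_add, map_smul, map_mul]

/-- **THE SMEARED TAIL'S MEMBER DIFFERENCE, parametric in the step data**: in k3c2-p1 g5's grid step data (`N = 4M`, `C′ = SᵀC^K_{>e₀}S` Gram-bounded `κ`, row/column sums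
`α`, counterterm size `N₁`, weight `ρ`, `θ = eα‖Ṽ‖_h/κ² < 1`, `A = e‖Ṽ‖_h/(1−θ)`), for momentum-label matrices `D′, D₁` with `IsGramBoundedR (SᵀD′S) γ`,
`IsGramBoundedR (SᵀD₁S) κD`, `4γ²θρ⁻² ≤ 1/2`, `16κD²θρ⁻² ≤ 1/2`, and every string `X`:
`‖𝒱₄(e^{Δ_{D₁+D′}}T₃)(X) − 𝒱₄(e^{Δ_{D′}}T₃)(X)‖ ≤ (96N/β)·(4096·ρ⁻⁶·κD²·(A(1+8γ²ρ⁻²))·θ²·(1+32κD²ρ⁻²))`, `T₃` the momentum-space tail over `C^K_{>e₀}`.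
[cite: BenfattoGiulianiMastropietro2006, (2.13)-(2.14) and (2.77)-(2.80)] -/
theorem norm_vertexFn_smearedTail_sub_le_of_gridStep {β : ℝ} (hβ : 0 < β) (U μ : ℝ) (K : TrigPolyC4v) {κ : ℝ} (hκ : 0 < κ)
    (hGB : IsGramBoundedR ((hubbardGridSub L M β (2 * (2 * M))).transpose * hubbardCovAboveCT L M β μ 0 K klE0 *
      hubbardGridSub L M β (2 * (2 * M))) κ)
    {α : ℝ} (hα : 0 < α)
    (hrow : ∀ X, ∑ Y, ‖((hubbardGridSub L M β (2 * (2 * M))).transpose * hubbardCovAboveCT L M β μ 0 K klE0 *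
      hubbardGridSub L M β (2 * (2 * M))) X Y‖ ≤ α)
    (hcol : ∀ Y, ∑ X, ‖((hubbardGridSub L M β (2 * (2 * M))).transpose * hubbardCovAboveCT L M β μ 0 K klE0 *
      hubbardGridSub L M β (2 * (2 * M))) X Y‖ ≤ α)
    {ρ : ℝ} (hρ : 0 < ρ) {N₁ : ℝ} (hN₁ : 0 ≤ N₁)
    (hct : ∀ (j : Fin 2) (w : GridLeg (GridPoint L (2 * (2 * M)))),
      ∑ Y ∈ univ.filter (fun Y : Fin 2 → GridLeg (GridPoint L (2 * (2 * M))) => Y j = w),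
        ‖kernel ℂ (hubbardGridCounterQuadratic L (2 * (2 * M)) β K) 2 Y‖ ≤ N₁)
    (hθ : Real.exp 1 * α * normV (GridLeg (GridPoint L (2 * (2 * M)))) κ ρ
      (fun m' : ℕ => if m' = 1 then N₁ else if m' = 2 then |U| * |β| / (2 * (2 * M) : ℕ) else 0) / κ ^ 2 < 1)
    {D' D₁ : Matrix (HubbardFieldIdx L M) (HubbardFieldIdx L M) ℂ} {γ κD : ℝ} (hγ : 0 ≤ γ) (hκD : 0 ≤ κD)
    (hGBγ : IsGramBoundedR ((hubbardGridSub L M β (2 * (2 * M))).transpose * D' * hubbardGridSub L M β (2 * (2 * M))) γ)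
    (hGBD : IsGramBoundedR ((hubbardGridSub L M β (2 * (2 * M))).transpose * D₁ * hubbardGridSub L M β (2 * (2 * M))) κD)
    (hy : 4 * (γ ^ 2 * (Real.exp 1 * α * normV (GridLeg (GridPoint L (2 * (2 * M)))) κ ρ
      (fun m' : ℕ => if m' = 1 then N₁ else if m' = 2 then |U| * |β| / (2 * (2 * M) : ℕ) else 0) / κ ^ 2) * ρ⁻¹ ^ 2) ≤ 1 / 2)
    (hz : 16 * (κD ^ 2 * (Real.exp 1 * α * normV (GridLeg (GridPoint L (2 * (2 * M)))) κ ρ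
      (fun m' : ℕ => if m' = 1 then N₁ else if m' = 2 then |U| * |β| / (2 * (2 * M) : ℕ) else 0) / κ ^ 2) * ρ⁻¹ ^ 2) ≤ 1 / 2)
    (X : Fin 4 → HubbardFieldIdx L M) :
    ‖vertexFn L M β (gaussConv ℂ (D₁ + D')
          (effAction ℂ (hubbardCovAboveCT L M β μ 0 K (klScale klE0 0)) (hubbardInteractionCT L M β U K) -
              gaussConv ℂ (hubbardCovAboveCT L M β μ 0 K (klScale klE0 0)) (hubbardInteractionCT L M β U K) +
            (2 : ℂ)⁻¹ • (gaussConv ℂ (hubbardCovAboveCT L M β μ 0 K (klScale klE0 0)) (hubbardInteractionCT L M β U K * hubbardInteractionCT L M β U K) -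
              gaussConv ℂ (hubbardCovAboveCT L M β μ 0 K (klScale klE0 0)) (hubbardInteractionCT L M β U K) *
                gaussConv ℂ (hubbardCovAboveCT L M β μ 0 K (klScale klE0 0)) (hubbardInteractionCT L M β U K)))) 4 X -
        vertexFn L M β (gaussConv ℂ D'
          (effAction ℂ (hubbardCovAboveCT L M β μ 0 K (klScale klE0 0)) (hubbardInteractionCT L M β U K) -
              gaussConv ℂ (hubbardCovAboveCT L M β μ 0 K (klScale klE0 0)) (hubbardInteractionCT L M β U K) +
            (2 : ℂ)⁻¹ • (gaussConv ℂ (hubbardCovAboveCT L M β μ 0 K (klScale klE0 0)) (hubbardInteractionCT L M β U K * hubbardInteractionCT L M β U K) -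
              gaussConv ℂ (hubbardCovAboveCT L M β μ 0 K (klScale klE0 0)) (hubbardInteractionCT L M β U K) *
                gaussConv ℂ (hubbardCovAboveCT L M β μ 0 K (klScale klE0 0)) (hubbardInteractionCT L M β U K)))) 4 X‖ ≤
      96 * ((2 * (2 * M) : ℕ) : ℝ) / β *
        (4096 * ρ⁻¹ ^ 6 * κD ^ 2 *
          (Real.exp 1 * normV (GridLeg (GridPoint L (2 * (2 * M)))) κ ρ
                (fun m' : ℕ => if m' = 1 then N₁ else if m' = 2 then |U| * |β| / (2 * (2 * M) : ℕ) else 0) /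
              (1 - Real.exp 1 * α * normV (GridLeg (GridPoint L (2 * (2 * M)))) κ ρ
                (fun m' : ℕ => if m' = 1 then N₁ else if m' = 2 then |U| * |β| / (2 * (2 * M) : ℕ) else 0) / κ ^ 2) *
            (1 + 8 * (γ ^ 2 * ρ⁻¹ ^ 2))) *
          (Real.exp 1 * α * normV (GridLeg (GridPoint L (2 * (2 * M)))) κ ρ
              (fun m' : ℕ => if m' = 1 then N₁ else if m' = 2 then |U| * |β| / (2 * (2 * M) : ℕ) else 0) / κ ^ 2) ^ 2 *
          (1 + 32 * (κD ^ 2 * ρ⁻¹ ^ 2))) := by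
  -- notation
  set Ng : ℕ := 2 * (2 * M) with hNg
  haveI : NeZero Ng := ⟨by rw [hNg]; have := NeZero.ne M; omega⟩
  set S := hubbardGridSub L M β Ng with hS
  set prof : ℕ → ℝ := fun m' : ℕ => if m' = 1 then N₁ else if m' = 2 then |U| * |β| / Ng else 0 with hprof
  set nV : ℝ := normV (GridLeg (GridPoint L Ng)) κ ρ prof with hnV
  set θ : ℝ := Real.exp 1 * α * nV / κ ^ 2 with hθdef
  set A : ℝ := Real.exp 1 * nV / (1 - θ) with hA
  have hL : (0 : ℝ) < L := by exact_mod_cast Nat.pos_of_ne_zero (NeZero.ne L)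
  have hnV0 : 0 ≤ nV := by rw [hnV]; exact normV_nonneg hκ.le hρ.le (klsv_profile_nonneg β U Ng hN₁)
  have hθ0 : 0 ≤ θ := by positivity
  have hθ1 : θ < 1 := hθ
  have hA0 : 0 ≤ A := div_nonneg (by positivity) (by linarith)
  -- (1) the tail's profile (F4a) and its parity
  obtain ⟨hT_even, hNT⟩ := scaleZero_tail_pinned_le (L := L) (M := M) (β := β) U μ K hκ hGB hα hrow hcol hρ hN₁ hct hθ
  set NT : ℕ → ℝ := fun m' => ρ⁻¹ ^ (2 * m') * A * θ ^ max 2 (m' - 2) with hNTdef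
  have hNT0 : ∀ m', 0 ≤ NT m' := fun m' => by positivity
  -- (2) the momentum-space tail as a grid image, and the two smearings pulled back
  have hsc : klScale klE0 0 = klE0 := by simp [klScale]
  rw [hsc, scaleZero_tail_eq_map_grid (L := L) (M := M) hβ.ne' U μ K klE0, gaussConv_map, gaussConv_map, LinearMap.toMatrix'_toLin',
    Matrix.mul_add, Matrix.add_mul]
  -- (3) the two-level binomial–Gram values lemma
  have hmain := klmg_vertexFn_map_gaussConv_sub_le_binomial₂ L M β hβ Ng hκD hGBD hγ hGBγ _ hT_even NT hNT0
    (fun m' j w => (hNT m' j w).trans (le_of_eq (by rw [hNTdef]))) (p := 2) two_pos X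
  refine hmain.trans ?_
  -- (4) the two series majorants
  have hinner : ∀ m' : ℕ, 2 < m' →
      (∑ m'' ∈ range (Fintype.card (GridLeg (GridPoint L Ng)) / 2 + 1),
        if m' ≤ m'' then ((2 * m'').choose (2 * m') : ℝ) * γ ^ (2 * m'' - 2 * m') * NT m'' else 0) ≤
        (2 * ρ⁻¹) ^ (2 * m') * (A * (1 + 8 * (γ ^ 2 * ρ⁻¹ ^ 2))) * θ ^ max 2 (m' - 2) := fun m' hm' => by
    simp only [hNTdef]
    exact klst_inner_twoRegime_le _ hγ hθ0 hθ1.le (by positivity) hA0 hy (by omega)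
  have houter : (∑ m' ∈ range (Fintype.card (GridLeg (GridPoint L Ng)) / 2 + 1),
      if 2 < m' then ((2 * m').choose (2 * 2) : ℝ) * κD ^ (2 * m' - 2 * 2) *
        (∑ m'' ∈ range (Fintype.card (GridLeg (GridPoint L Ng)) / 2 + 1),
          if m' ≤ m'' then ((2 * m'').choose (2 * m') : ℝ) * γ ^ (2 * m'' - 2 * m') * NT m'' else 0) else 0) ≤
      4096 * ρ⁻¹ ^ 6 * κD ^ 2 * (A * (1 + 8 * (γ ^ 2 * ρ⁻¹ ^ 2))) * θ ^ 2 * (1 + 32 * (κD ^ 2 * ρ⁻¹ ^ 2)) := by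
    have hle : (∑ m' ∈ range (Fintype.card (GridLeg (GridPoint L Ng)) / 2 + 1),
        if 2 < m' then ((2 * m').choose (2 * 2) : ℝ) * κD ^ (2 * m' - 2 * 2) *
          (∑ m'' ∈ range (Fintype.card (GridLeg (GridPoint L Ng)) / 2 + 1),
            if m' ≤ m'' then ((2 * m'').choose (2 * m') : ℝ) * γ ^ (2 * m'' - 2 * m') * NT m'' else 0) else 0) ≤
        ∑ m' ∈ range (Fintype.card (GridLeg (GridPoint L Ng)) / 2 + 1),
          if 2 < m' then ((2 * m').choose (2 * 2) : ℝ) * κD ^ (2 * m' - 2 * 2) *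
            ((2 * ρ⁻¹) ^ (2 * m') * (A * (1 + 8 * (γ ^ 2 * ρ⁻¹ ^ 2))) * θ ^ max 2 (m' - 2)) else 0 := by
      refine sum_le_sum fun m' _ => ?_
      split_ifs with hm
      · exact mul_le_mul_of_nonneg_left (hinner m' hm) (by positivity)
      · exact le_rfl
    exact hle.trans (klst_outer_twoRegime_le _ hκD hθ0 hθ1.le (by positivity) (by positivity) hz)
  -- (5) the prefactor `(4!/(βL²))·#legs = 96·N/β`
  rw [card_gridLeg_gridPoint, show ((Nat.factorial (2 * 2) : ℕ) : ℝ) = 24 by norm_num [Nat.factorial]]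
  rw [card_gridLeg_gridPoint] at houter
  calc (24 : ℝ) / (β * (L : ℝ) ^ 2) * (((4 * Ng * L ^ 2 : ℕ) : ℝ) * _)
      ≤ (24 : ℝ) / (β * (L : ℝ) ^ 2) * (((4 * Ng * L ^ 2 : ℕ) : ℝ) *
          (4096 * ρ⁻¹ ^ 6 * κD ^ 2 * (A * (1 + 8 * (γ ^ 2 * ρ⁻¹ ^ 2))) * θ ^ 2 * (1 + 32 * (κD ^ 2 * ρ⁻¹ ^ 2)))) :=
        mul_le_mul_of_nonneg_left (mul_le_mul_of_nonneg_left houter (by positivity)) (by positivity)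
    _ = 96 * ((Ng : ℕ) : ℝ) / β * (4096 * ρ⁻¹ ^ 6 * κD ^ 2 * (A * (1 + 8 * (γ ^ 2 * ρ⁻¹ ^ 2))) * θ ^ 2 * (1 + 32 * (κD ^ 2 * ρ⁻¹ ^ 2))) := by
        push_cast
        field_simp
        ring

end Grid

end Summit.HubbardSuperconductivity.HubbardSuperconductivity.Theorems.EngineV8

end
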